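import Mathlib
import HarnessLib
import Summits.ValiantsHypothesis.ValiantsHypothesis.Theses.MonotoneRestoration
import Summits.ValiantsHypothesis.ValiantsHypothesis.Theorems.MonotoneRestorationMonotoneRestorationQPEpsilonComplex
import Summits.ValiantsHypothesis.ValiantsHypothesis.Theorems.MonotoneRestorationMonotoneRestorationQPSparseRegime
import Literature.Computability.AlgebraicComplexity.PatternExpressions
import Literature.Computability.AlgebraicComplexity.DawarWilsenach2025
import Literature.Computability.AlgebraicComplexity.SymmetricOrbitCircuitEval
import Literature.Combinatorics.SimpleGraph.TreeDecomposition

/-!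
# Skeleton — crux `MonotoneRestorationQP` (stmt-ValiantsHypothesis-15886), line `linear-width`
(forward generator G4 `ladder-down`, unit fwd-ladder-ValiantsHypothesis-50, 2026-08-17)

LADDER TOP.  After THEOREM ε the crux is `L1 ∧ L2` (registered line `orbit-compression`):
L1 = `OrbitRestorationQP` (every matrix-symmetric `VP` family over `ℂ` has square-symmetric circuits
of quasi-polynomial ORBIT size; `L1 → ValiantsHypothesis` is `orbitRestoration_decides` /
the route's `closes`), L2 = `OrbitCompressionQP`.  L1 stands in for the summit.

GRADATION (L1's own language).  By the Dawar–Wilsenach support theorem (tree: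
`not_qpOrbitSymmetric_of_polylogSeparating`; Dawar–Pago–Seppelt 2025 Thm 6.2) the conclusion of L1
FORCES polylogarithmic counting width on EDGE-WEIGHTED graphs, i.e. `PolylogHomDetermined` below
(values at `A, B ∈ ℂ^{n×n}` agree whenever all homomorphism polynomials of patterns of treewidth
`< (log₂ n + c)^c` agree at `A, B`; Dvořák / Dell–Grohe–Rattan).  So
  L1  ⟺  WidthRestorationQP ∧ HomDeterminedVP,
where `HomDeterminedVP` ("every matrix-symmetric VP family is polylog-hom-determined" = no arithmetic
Cai–Fürer–Immerman construction in characteristic 0) carries the summit, and `WidthRestorationQP`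
("polylog edge-weighted counting width ⇒ quasi-polynomial orbits", for VP families) is the
quasi-polynomial form of the OPEN converse of Dawar–Pago–Seppelt 2025 Thm 6.3 (ITCS 2026, p. 5:
"Is bounded counting width a sufficient criterion for the existence of orbit-small symmetric
circuits?").  `WidthRestorationQP` is graded by the DEGREE budget `d` of the family —
`WidthRung d` — and in print / in tree:
* `d = polylog`      : PROVED here (`widthRung_polylogDegree`, the orbit circuit; width hypothesis idle)
                       — the FLOOR (= `monotoneRestorationQP_of_polylogDegree`, p-landed, in orbit form);
* `d = o(n)` volume  : bounded scale PROVED in print (Dawar–Pago–Seppelt 2025 Thm 3.3: for linear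
                       combinations of hom polynomials of SUBLINEAR volume, bounded counting width on
                       simple graphs ⟺ bounded treewidth ⟺ polynomial orbits);
* `d = c·(n+1)`      : THE RUNG `stub_linearDegreeWidthRestoration` (linear degree = linear volume:
                       Dwivedi–Pago–Seppelt 2026 Outlook, "linear combinations of linear volume …
                       an intriguing open problem", p. 12), where the sublinear proof stops: the
                       non-uniform homomorphism-distinguishing closure needs host size `≫` pattern size
                       (DPS25 Thm 7.3, `f(χ)·|F|`), although expansions are still UNIQUE up to volume `n`
                       (DPS26 Lem 8.2, p. 34);
* `d = poly`         : `stub_degreeLifting : LinearDegree… → WidthRestorationQP` — the gap where the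
                       width hypothesis SATURATES: for every matrix-symmetric `h`, the product
                       `Disc(row sums)² · Disc(column sums)² · h` (degree `2n(n-1) + deg h`) has
                       edge-weighted counting width `2` (certified remark `…` in the card; all-distinct
                       row sums individualise colour refinement), so from degree `≈ n²` on the width
                       hypothesis can hold "for free" and must be re-earned from `IsVPFamily`;
* `HomDeterminedVP`  : `stub_homDeterminedVP` — summit-strength (with `WidthRestorationQP` it gives L1,
                       hence VH; alone it is L1 in counting-width currency), typed, not attacked here;
* `stub_orbitCompression` : L2 verbatim (shared with line `orbit-compression`).
`MonotoneRestorationQP_of` composes the four stubs BY NAME (THEOREM ε + the above); no other sorry.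
Certified remarks (proved): `widthRung_polylogDegree` (floor = F3 witness), `widthRung_mono`
(the family is monotone in `d`), `orbitRestorationQP_of_ladder` (rung-free form for crux
`OrbitRestorationQP`, stmt-18293), `orbitRestorationQP_implies_widthRestorationQP` (on-path: L1 ⇒ every
rung).
-/

set_option linter.dupNamespace false

noncomputable section

namespace Summit.ValiantsHypothesis.ValiantsHypothesis.Cruxes.MonotoneRestorationQP.LinearWidth

open Summit.ValiantsHypothesis.ValiantsHypothesis.Theses.MonotoneRestoration
open Summit.ValiantsHypothesis.ValiantsHypothesis.Theorems
open Literature.Computability.AlgebraicComplexity MvPolynomial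

/-! ### The graded family -/

/-- Matrix symmetry of a family over `ℂ` (invariance under independent row and column permutations),
literally the hypothesis of `OrbitRestorationQP`. [cite: DawarPagoSeppelt2025, §1] -/
def IsMatrixSymmetric (f : (n : ℕ) → MvPolynomial (Fin n × Fin n) ℂ) : Prop :=
  ∀ (n : ℕ) (σ τ : Equiv.Perm (Fin n)),
    MvPolynomial.rename (fun p : Fin n × Fin n => (σ p.1, τ p.2)) (f n) = f n

/-- The pattern graph (on `Fin a ⊕ Fin b`) of a bipartite multigraph pattern, as in line
`pattern-width` of crux `OrbitRestorationQP`. [cite: DawarPagoSeppelt2025, §2] -/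
def patternGraph {a b : ℕ} (E : Multiset (Fin a × Fin b)) : SimpleGraph (Fin a ⊕ Fin b) :=
  SimpleGraph.fromRel fun u v => ∃ p ∈ E, u = Sum.inl p.1 ∧ v = Sum.inr p.2

/-- Two points `A, B ∈ ℂ^{n×n}` (edge-weighted `(n,n)`-vertex bipartite graphs) are HOMOMORPHISM
INDISTINGUISHABLE BELOW TREEWIDTH `k`: every homomorphism polynomial of a bipartite multigraph pattern
of treewidth `< k` takes the same value at `A` and at `B` (for simple / edge-weighted graphs this is
`C^k`-equivalence: Dvořák 2010, Dell–Grohe–Rattan 2018). [cite: DwivediPagoSeppelt2026, Def. 3.2] -/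
def HomIndist (n k : ℕ) (A B : Fin n × Fin n → ℂ) : Prop :=
  ∀ (a b : ℕ) (E : Multiset (Fin a × Fin b)),
    Literature.Combinatorics.SimpleGraph.treewidth (patternGraph E) < k →
    MvPolynomial.eval A (homPoly E n ℂ) = MvPolynomial.eval B (homPoly E n ℂ)

/-- `f` is POLYLOG-HOM-DETERMINED: for one exponent `c` and every `n`, the value of `f n` at a point of
`ℂ^{n×n}` is determined by the values of the homomorphism polynomials of patterns of treewidth
`< (log₂ n + c)^c` — counting width `≤ polylog` on EDGE-WEIGHTED graphs in the sense of
Dawar–Pago–Seppelt 2025 Def 6.1 (second item). [cite: DawarPagoSeppelt2025, Def. 6.1, Thm. 6.3] -/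
def PolylogHomDetermined (f : (n : ℕ) → MvPolynomial (Fin n × Fin n) ℂ) : Prop :=
  ∃ c : ℕ, ∀ (n : ℕ) (A B : Fin n × Fin n → ℂ),
    HomIndist n ((Nat.log 2 n + c) ^ c) A B →
    MvPolynomial.eval A (f n) = MvPolynomial.eval B (f n)

/-- The conclusion of `OrbitRestorationQP` for one family: square-symmetric circuits of
quasi-polynomial ORBIT size. [cite: DawarWilsenach2025, §3.3] -/
def QPOrbitSymm (f : (n : ℕ) → MvPolynomial (Fin n × Fin n) ℂ) : Prop :=
  ∃ c : ℕ, ∀ n : ℕ, ∃ (G : Type) (_ : Fintype G)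
    (C : LabelledArithCircuit ℂ (Fin n × Fin n) Unit G),
    C.IsSymmetric (Equiv.Perm (Fin n)) ∧ C.eval (C.output ()) = f n ∧
      C.orbitSize (Equiv.Perm (Fin n)) ≤ 2 ^ ((Nat.log 2 n + c) ^ c)

/-- **The graded family `WidthRung d`** (degree budget `d : ℕ → ℕ`): every matrix-symmetric `VP`
family of total degree `≤ d n` that is polylog-hom-determined has square-symmetric circuits of
quasi-polynomial orbit size.  Antitone in `d` (`widthRung_mono`); `d = polylog` is the proved floor,
`d` linear the rung, `d` unrestricted = `WidthRestorationQP`. [new] -/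
def WidthRung (d : ℕ → ℕ) : Prop :=
  ∀ f : (n : ℕ) → MvPolynomial (Fin n × Fin n) ℂ,
    IsMatrixSymmetric f → IsVPFamily f → (∀ n, (f n).totalDegree ≤ d n) →
    PolylogHomDetermined f → QPOrbitSymm f

/-- FLOOR `θ₀`: polylogarithmic degree (proved below, `widthRung_polylogDegree`). [new] -/
def PolylogDegreeWidthRestoration : Prop :=
  ∀ c : ℕ, WidthRung fun n => (Nat.log 2 n + c) ^ c

/-- RUNG `θ₁`: LINEAR degree (= linear volume of the hom expansion). [new] -/
def LinearDegreeWidthRestoration : Prop :=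
  ∀ c : ℕ, WidthRung fun n => c * (n + 1)

/-- `WidthRestorationQP` (all degrees): quasi-polynomial EDGE-WEIGHTED WIDTH-TO-ORBIT restoration for
matrix-symmetric `VP` families — the qp form of the open converse of Dawar–Pago–Seppelt 2025 Thm 6.3.
[cite: DawarPagoSeppelt2025, §1 (p. 5), Thm. 6.3] -/
def WidthRestorationQP : Prop :=
  ∀ f : (n : ℕ) → MvPolynomial (Fin n × Fin n) ℂ,
    IsMatrixSymmetric f → IsVPFamily f → PolylogHomDetermined f → QPOrbitSymm f

/-- `HomDeterminedVP` — NO ARITHMETIC CFI IN CHARACTERISTIC 0: every matrix-symmetric `VP` family over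
`ℂ` is polylog-hom-determined (has polylog counting width on edge-weighted graphs).  Summit-strength:
it is what `OrbitRestorationQP` says in counting-width currency (L1 ⇒ it by the support theorem;
with `WidthRestorationQP` it gives L1 back). [cite: DawarWilsenach2025, §8 (p. 29); DwivediPagoSeppelt2026, Cor. 3.3] -/
def HomDeterminedVP : Prop :=
  ∀ f : (n : ℕ) → MvPolynomial (Fin n × Fin n) ℂ,
    IsMatrixSymmetric f → IsVPFamily f → PolylogHomDetermined f

/-! ### The four stubs -/

/-- **RUNG (crux of the line) — LINEAR-DEGREE WIDTH-TO-ORBIT RESTORATION.** Every matrix-symmetric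
`VP` family over `ℂ` of total degree `≤ c·(n+1)` whose values are polylog-hom-determined has
square-symmetric circuits of orbit size `≤ 2^((log₂ n + c')^c')`.  The next rung above the proved
sublinear-volume dichotomy (Dawar–Pago–Seppelt 2025 Thm 3.3) and the in-tree polylog-degree floor;
the linear-volume regime Dwivedi–Pago–Seppelt 2026 (Outlook, p. 12) single out as open.  VH-free by
construction: the only orbit lower-bound instrument (counting width) is the hypothesis.
[conjecture-grade; cite: DawarPagoSeppelt2025, Thm 3.3, §1 p. 5; DwivediPagoSeppelt2026, Outlook p. 12, Lem 8.2] -/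
theorem stub_linearDegreeWidthRestoration : LinearDegreeWidthRestoration := by
  sorry

/-- **GAP 1 — DEGREE LIFTING.** Linear-degree width-to-orbit restoration implies width-to-orbit
restoration for all matrix-symmetric `VP` families.  This is where the width hypothesis saturates
(`Disc(row sums)²·Disc(col sums)²·h` is `C²`-determined for every invariant `h`, degree `≈ n² + deg h`),
so `IsVPFamily` must be used; no reduction of degree preserving matrix symmetry is known.
[conjecture-grade; cite: DawarPagoSeppelt2025, Ex. 6.4, §1 p. 5] -/
theorem stub_degreeLifting : LinearDegreeWidthRestoration → WidthRestorationQP := by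
  sorry

/-- **GAP 2 — NO ARITHMETIC CFI (summit-strength, typed, not attacked by this line).**
[conjecture-grade; cite: DawarWilsenach2025, §8 (p. 29); DwivediPagoSeppelt2026, Outlook Q3 (p. 12)] -/
theorem stub_homDeterminedVP : HomDeterminedVP := by
  sorry

/-- **L2 — ORBIT-TO-SIZE COMPRESSION**, verbatim the registered stub of line `orbit-compression`
(shared). [conjecture-grade; cite: DawarWilsenach2025 §3.3, §6; DawarPagoSeppelt2025 §5] -/
theorem stub_orbitCompression :
    ∀ f : (n : ℕ) → MvPolynomial (Fin n × Fin n) ℂ,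
      (∀ (n : ℕ) (σ τ : Equiv.Perm (Fin n)),
        MvPolynomial.rename (fun p : Fin n × Fin n => (σ p.1, τ p.2)) (f n) = f n) →
      IsVPFamily f →
      (∃ c : ℕ, ∀ n : ℕ, ∃ (G : Type) (_ : Fintype G)
        (C : LabelledArithCircuit ℂ (Fin n × Fin n) Unit G),
        C.IsSymmetric (Equiv.Perm (Fin n)) ∧ C.eval (C.output ()) = f n ∧
          C.orbitSize (Equiv.Perm (Fin n)) ≤ 2 ^ ((Nat.log 2 n + c) ^ c)) →
      ∃ c : ℕ, ∀ n : ℕ, ∃ (G : Type) (_ : Fintype G)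
        (C : LabelledArithCircuit ℂ (Fin n × Fin n) Unit G),
        C.IsSymmetric (Equiv.Perm (Fin n)) ∧ C.eval (C.output ()) = f n ∧
          Fintype.card G ≤ 2 ^ ((Nat.log 2 n + c) ^ c) := by
  sorry

/-! ### Proved: compositions -/

/-- Rung-free form for crux `OrbitRestorationQP` (stmt-ValiantsHypothesis-18293):
`WidthRestorationQP → HomDeterminedVP → OrbitRestorationQP`. [folklore] -/
theorem orbitRestorationQP_of_width (hW : WidthRestorationQP) (hH : HomDeterminedVP) :
    OrbitRestorationQP :=
  fun f hs hVP => hW f hs hVP (hH f hs hVP)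

/-- **The ladder concludes `OrbitRestorationQP`** from rung + gap 1 + gap 2. [folklore] -/
theorem orbitRestorationQP_of_ladder (h₁ : LinearDegreeWidthRestoration)
    (h₂ : LinearDegreeWidthRestoration → WidthRestorationQP) (h₃ : HomDeterminedVP) :
    OrbitRestorationQP :=
  orbitRestorationQP_of_width (h₂ h₁) h₃

/-- **THE LINE CONCLUDES THE CRUX** `MonotoneRestorationQP` from the four stub STATEMENTS
(rung, degree lifting, no-arithmetic-CFI, L2): THEOREM ε (`monotoneRestorationQP_iff_complexRestorationQP`)
+ the ladder composition. [folklore] -/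
theorem MonotoneRestorationQP_of :
    LinearDegreeWidthRestoration →
    (LinearDegreeWidthRestoration → WidthRestorationQP) →
    HomDeterminedVP →
    (∀ f : (n : ℕ) → MvPolynomial (Fin n × Fin n) ℂ,
      (∀ (n : ℕ) (σ τ : Equiv.Perm (Fin n)),
        MvPolynomial.rename (fun p : Fin n × Fin n => (σ p.1, τ p.2)) (f n) = f n) →
      IsVPFamily f →
      (∃ c : ℕ, ∀ n : ℕ, ∃ (G : Type) (_ : Fintype G)
        (C : LabelledArithCircuit ℂ (Fin n × Fin n) Unit G),
        C.IsSymmetric (Equiv.Perm (Fin n)) ∧ C.eval (C.output ()) = f n ∧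
          C.orbitSize (Equiv.Perm (Fin n)) ≤ 2 ^ ((Nat.log 2 n + c) ^ c)) →
      ∃ c : ℕ, ∀ n : ℕ, ∃ (G : Type) (_ : Fintype G)
        (C : LabelledArithCircuit ℂ (Fin n × Fin n) Unit G),
        C.IsSymmetric (Equiv.Perm (Fin n)) ∧ C.eval (C.output ()) = f n ∧
          Fintype.card G ≤ 2 ^ ((Nat.log 2 n + c) ^ c)) →
    MonotoneRestorationQP := by
  intro h₁ h₂ h₃ h₄
  exact monotoneRestorationQP_iff_complexRestorationQP.mpr fun f hs hVP =>
    h₄ f hs hVP (orbitRestorationQP_of_ladder h₁ h₂ h₃ f hs hVP)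

/-- The crux from the four registered stubs, discharged by name. [folklore] -/
theorem monotoneRestorationQP_of_stubs : MonotoneRestorationQP :=
  MonotoneRestorationQP_of stub_linearDegreeWidthRestoration stub_degreeLifting
    stub_homDeterminedVP stub_orbitCompression

/-! ### Proved: the family is graded, the floor holds, the top implies every rung -/

/-- `WidthRung` is antitone in the degree budget. [folklore] -/
theorem widthRung_mono {d d' : ℕ → ℕ} (h : ∀ n, d n ≤ d' n) (hR : WidthRung d') : WidthRung d :=
  fun f hs hVP hd hdet => hR f hs hVP (fun n => (hd n).trans (h n)) hdet

/-- ON-PATH: the top `OrbitRestorationQP` implies `WidthRestorationQP` and every `WidthRung d`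
(the rungs are restrictions of L1). [folklore] -/
theorem orbitRestorationQP_implies_widthRestorationQP (h : OrbitRestorationQP) :
    WidthRestorationQP ∧ ∀ d, WidthRung d :=
  ⟨fun f hs hVP _ => h f hs hVP, fun _ f hs hVP _ _ => h f hs hVP⟩

/-- `WidthRestorationQP` is the top of the graded family: it gives every rung, and the linear rung
in particular. [folklore] -/
theorem widthRung_of_widthRestorationQP (h : WidthRestorationQP) (d : ℕ → ℕ) : WidthRung d :=
  fun f hs hVP _ hdet => h f hs hVP hdet

/-- **THE FLOOR (F3 witness): `WidthRung` at polylogarithmic degree is a theorem** — by the orbit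
circuit (`OrbitCircuit.exists_symmetric_circuit_of_invariant`: size, hence orbit size,
`≤ n² + |supp|·n²·deg + 2|supp| + 1`, and `|supp| ≤ (n²+1)^deg`); neither `IsVPFamily` nor the width
hypothesis is used.  Orbit form of the landed `monotoneRestorationQP_of_polylogDegree`. [folklore] -/
theorem widthRung_polylogDegree : PolylogDegreeWidthRestoration := by
  intro c f hs _hVP hdeg _hdet
  obtain ⟨c₁, hc₁⟩ := SparseRegime.polylogDegree_sparse_le c
  obtain ⟨c', hc'⟩ := SparseRegime.qpSparse_size_le c₁
  refine ⟨c', fun n => ?_⟩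
  have hinv : ∀ σ : Equiv.Perm (Fin n),
      rename (fun pq : Fin n × Fin n => σ • pq) (f n) = f n := fun σ => hs n σ σ
  obtain ⟨G, inst, C, hCs, hCe, hCc⟩ := OrbitCircuit.exists_symmetric_circuit_of_invariant (f n) hinv
  refine ⟨G, inst, C, hCs, hCe, (C.orbitSize_le_size (Equiv.Perm (Fin n))).trans
    (hCc.trans (hc' n _ _ ?_ (hc₁ n _ (hdeg n)).2))⟩
  calc (f n).support.card ≤ (Fintype.card (Fin n × Fin n) + 1) ^ (f n).totalDegree :=
        OrbitCircuit.card_support_le_of_totalDegree_le (f n) le_rfl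
    _ = (n * n + 1) ^ (f n).totalDegree := by rw [Fintype.card_prod, Fintype.card_fin]
    _ ≤ 2 ^ ((Nat.log 2 n + c₁) ^ c₁) := (hc₁ n _ (hdeg n)).1

/-- F3, literally: the rung family specialises to the proved floor. [folklore] -/
example (c : ℕ) : WidthRung fun n => (Nat.log 2 n + c) ^ c := widthRung_polylogDegree c

end Summit.ValiantsHypothesis.ValiantsHypothesis.Cruxes.MonotoneRestorationQP.LinearWidth

end
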